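import Summits.ResolutionOfSingularities.ResolutionOfSingularities.Theorems.FrobeniusClosingSteerBetaFaceSupport
import Summits.ResolutionOfSingularities.ResolutionOfSingularities.Theorems.FrobeniusClosingSteerBetaLetterPushIdent
import HarnessLib

/-!
# Crux `Steer` (stmt-ResolutionOfSingularities-16345), chain W4.1, β-LEAF, K-β2♭ part (III), file X4: the words `DeltaGe` / `DeltaFaceGe`
# read on minimal exponents (both directions), their up-closed regions, and two small consequences (def-free)

OURS (campaign `res-hironaka`, rung L ★L-G4, slot W4.1; statements about the route's own objects; they replace the
role of no printed item and are NOT statements of the manuscript under review [claim: Hironaka2017, status: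
under-review]; AI review is weaker than expert review). Seat res-D-pv-003 (gen 7), K-β2♭ owner; GLUE (III) per
res-L0-w41-plan-1 RULING 276(a).

* `forall_minExponents_of_deltaGe`, `uPow_mem_deltaGeIdeal`, `deltaGe_of_forall_minExponents` — `DeltaGe ρ` on `𝐒(f)`.
* `uPow_mem_deltaFaceGeIdeal`, `deltaFaceGe_of_forall_minExponents` — the converse reading of `DeltaFaceGe (δ, ρ)`.
* `deltaRegion_mono`, `deltaFaceRegion_mono` — the regions are up-closed.
* `deltaGe_one_of_mem_pow` — `f ∈ 𝔪^d ⇒ DeltaGe 1`; `deltaFaceGt_one_zero_of_nearX` — the `x`-near region gives `DeltaFaceGt (1, 0)`.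

[cite: CossartPiltant2019, Prop. 2.1] [cite: CossartJannsenSaito2020, (7.4)] No Theses file is imported; nothing here is a route item or
a registration.
-/

noncomputable section

-- `Summit.<S>.<S>.…` duplicates the summit name by design (single-problem summit).
set_option linter.dupNamespace false

namespace Summit.ResolutionOfSingularities.ResolutionOfSingularities.Theorems.SwitchingDichotomy.BetaNewton

open IsLocalRing
open Literature.AlgebraicGeometry.Resolution
open Literature.AlgebraicGeometry.Resolution.CossartPiltant (uPow uPow_mem_span_uPow minExponents)
open Summit.ResolutionOfSingularities.ResolutionOfSingularities.Theorems.SwitchingDichotomy.BetaPolygon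
open Summit.ResolutionOfSingularities.ResolutionOfSingularities.Theorems.SwitchingDichotomy.BetaLetter
  (uPow_four monomial_mem_pow_of_le threshold_le_span_uPow ceil_mul_mono floor_mul_mono span_four_pow_eq_span_uPow
    delta_le_poly)

variable {S : Type} [CommRing S]

/-! ## §1 `DeltaGe` on `𝐒(f)` -/

/-- The monomials of the `DeltaGe ρ` region lie in the `DeltaGe ρ` ideal. [folklore] -/
theorem uPow_mem_deltaGeIdeal (x y z w : S) (d : ℕ) (ρ : ℚ) {c : Fin 4 → ℕ}
    (hc : d ≤ c 2 + c 3 ∨ ⌈ρ * ((d - c 2 - c 3 : ℕ) : ℚ)⌉₊ ≤ c 0 + c 1) :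
    uPow ![x, y, z, w] c ∈ Ideal.span {z, w} ^ d ⊔
      ⨆ (i : ℕ) (j : ℕ) (_ : i + j < d), Ideal.span {x, y} ^ ⌈ρ * ((d - i - j : ℕ) : ℚ)⌉₊ * Ideal.span {z ^ i * w ^ j} := by
  rw [uPow_four]
  by_cases hzw : d ≤ c 2 + c 3
  · exact Ideal.mem_sup_left (monomial_mem_pow_of_le x y z w hzw)
  · push Not at hzw
    rw [show x ^ c 0 * y ^ c 1 * z ^ c 2 * w ^ c 3 = (x ^ c 0 * y ^ c 1) * (z ^ c 2 * w ^ c 3) by ring]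
    refine Ideal.mem_sup_right (Submodule.mem_iSup_of_mem (c 2) (Submodule.mem_iSup_of_mem (c 3)
      (Submodule.mem_iSup_of_mem hzw (Ideal.mul_mem_mul ?_ (Ideal.mem_span_singleton_self _)))))
    rcases hc with hc | hc
    · exact absurd hc (not_le.mpr hzw)
    · exact Ideal.pow_le_pow_right hc (pow_mul_pow_mem_span_pair_pow' x y (c 0) (c 1))

/-- **`DeltaGe` from the exponent condition on `𝐒(f)`.** [cite: CossartPiltant2019, Prop. 2.1] -/
theorem deltaGe_of_forall_minExponents [IsLocalRing S] {x y z w : S} (ht : IsRsopPart ![x, y, z, w]) {d : ℕ} (ρ : ℚ)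
    {f : S} (h : ∀ c ∈ minExponents ![x, y, z, w] f, d ≤ c 2 + c 3 ∨ ⌈ρ * ((d - c 2 - c 3 : ℕ) : ℚ)⌉₊ ≤ c 0 + c 1) :
    DeltaGe x y z w d ρ f :=
  mem_of_forall_minExponents_uPow_mem ht fun c hc => uPow_mem_deltaGeIdeal x y z w d ρ (h c hc)

/-- **`DeltaGe ρ` on `𝐒(f)`** (`ρ ≥ 0`). [cite: CossartPiltant2019, Prop. 2.1] -/
theorem forall_minExponents_of_deltaGe [IsLocalRing S] {x y z w : S} (ht : IsRsopPart ![x, y, z, w]) {d : ℕ} {ρ : ℚ}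
    (hρ : 0 ≤ ρ) {f : S} (hf : DeltaGe x y z w d ρ f) :
    ∀ c ∈ minExponents ![x, y, z, w] f, d ≤ c 2 + c 3 ∨ ⌈ρ * ((d - c 2 - c 3 : ℕ) : ℚ)⌉₊ ≤ c 0 + c 1 := by
  intro c hc
  have h' := threshold_le_span_uPow x y z w d (fun n a b => ⌈ρ * (n : ℚ)⌉₊ ≤ a + b) (delta_le_poly x y z w d ρ hf)
  obtain ⟨b, hb, hbc⟩ := exists_le_of_mem_span_uPow ht h' hc
  by_cases hzw : d ≤ c 2 + c 3
  · exact Or.inl hzw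
  · right
    rcases hb with hb | ⟨-, hb⟩
    · exact absurd (hb.trans (Nat.add_le_add (hbc 2) (hbc 3))) hzw
    · have h0 : b 0 ≤ c 0 := hbc 0; have h1 : b 1 ≤ c 1 := hbc 1
      have h2 : b 2 ≤ c 2 := hbc 2; have h3 : b 3 ≤ c 3 := hbc 3
      have hmn : d - c 2 - c 3 ≤ d - b 2 - b 3 := by omega
      exact (ceil_mul_mono hρ hmn).trans (hb.trans (Nat.add_le_add h0 h1))

/-- The `DeltaGe ρ` region is up-closed (`ρ ≥ 0`). [folklore] -/
theorem deltaRegion_mono {d : ℕ} {ρ : ℚ} (hρ : 0 ≤ ρ) {b a : Fin 4 → ℕ} (hba : b ≤ a)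
    (hb : d ≤ b 2 + b 3 ∨ ⌈ρ * ((d - b 2 - b 3 : ℕ) : ℚ)⌉₊ ≤ b 0 + b 1) :
    d ≤ a 2 + a 3 ∨ ⌈ρ * ((d - a 2 - a 3 : ℕ) : ℚ)⌉₊ ≤ a 0 + a 1 := by
  have h0 : b 0 ≤ a 0 := hba 0; have h1 : b 1 ≤ a 1 := hba 1
  have h2 : b 2 ≤ a 2 := hba 2; have h3 : b 3 ≤ a 3 := hba 3
  have hm : d - a 2 - a 3 ≤ d - b 2 - b 3 := by omega
  rcases hb with hb | hb
  · left; omega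
  · right; exact (ceil_mul_mono hρ hm).trans (hb.trans (Nat.add_le_add h0 h1))

/-! ## §2 `DeltaFaceGe` on `𝐒(f)`, converse direction -/

/-- The monomials of the `DeltaFaceGe (δ, ρ)` region lie in the `DeltaFaceGe` ideal. [folklore] -/
theorem uPow_mem_deltaFaceGeIdeal (x y z w : S) (d : ℕ) (δ ρ : ℚ) {c : Fin 4 → ℕ}
    (hc : d ≤ c 2 + c 3 ∨ ⌊δ * ((d - c 2 - c 3 : ℕ) : ℚ)⌋₊ + 1 ≤ c 0 + c 1 ∨
      (⌈δ * ((d - c 2 - c 3 : ℕ) : ℚ)⌉₊ ≤ c 0 + c 1 ∧ ⌈ρ * ((d - c 2 - c 3 : ℕ) : ℚ)⌉₊ ≤ c 1)) :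
    uPow ![x, y, z, w] c ∈ Ideal.span {z, w} ^ d ⊔
      ⨆ (i : ℕ) (j : ℕ) (_ : i + j < d),
        (Ideal.span {x, y} ^ (⌊δ * ((d - i - j : ℕ) : ℚ)⌋₊ + 1) ⊔
          Ideal.span {y ^ ⌈ρ * ((d - i - j : ℕ) : ℚ)⌉₊} *
            Ideal.span {x, y} ^ (⌈δ * ((d - i - j : ℕ) : ℚ)⌉₊ - ⌈ρ * ((d - i - j : ℕ) : ℚ)⌉₊)) *
          Ideal.span {z ^ i * w ^ j} := by
  rw [uPow_four]
  by_cases hzw : d ≤ c 2 + c 3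
  · exact Ideal.mem_sup_left (monomial_mem_pow_of_le x y z w hzw)
  · push Not at hzw
    rw [show x ^ c 0 * y ^ c 1 * z ^ c 2 * w ^ c 3 = (x ^ c 0 * y ^ c 1) * (z ^ c 2 * w ^ c 3) by ring]
    refine Ideal.mem_sup_right (Submodule.mem_iSup_of_mem (c 2) (Submodule.mem_iSup_of_mem (c 3)
      (Submodule.mem_iSup_of_mem hzw (Ideal.mul_mem_mul ?_ (Ideal.mem_span_singleton_self _)))))
    set n : ℕ := d - c 2 - c 3 with hn
    rcases hc with hc | hc | ⟨hc1, hc2⟩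
    · exact absurd hc (not_le.mpr hzw)
    · exact Ideal.mem_sup_left (Ideal.pow_le_pow_right hc (pow_mul_pow_mem_span_pair_pow' x y (c 0) (c 1)))
    · refine Ideal.mem_sup_right ?_
      rw [show x ^ c 0 * y ^ c 1 = y ^ ⌈ρ * (n : ℚ)⌉₊ * (x ^ c 0 * y ^ (c 1 - ⌈ρ * (n : ℚ)⌉₊)) by
        rw [mul_left_comm, ← pow_add, Nat.add_sub_cancel' hc2]]
      refine Ideal.mul_mem_mul (Ideal.mem_span_singleton_self _) (Ideal.pow_le_pow_right ?_
        (pow_mul_pow_mem_span_pair_pow' x y (c 0) (c 1 - ⌈ρ * (n : ℚ)⌉₊)))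
      omega

/-- **`DeltaFaceGe` from the exponent condition on `𝐒(f)`.** [cite: CossartPiltant2019, Prop. 2.1] -/
theorem deltaFaceGe_of_forall_minExponents [IsLocalRing S] {x y z w : S} (ht : IsRsopPart ![x, y, z, w]) {d : ℕ}
    (δ ρ : ℚ) {f : S}
    (h : ∀ c ∈ minExponents ![x, y, z, w] f, d ≤ c 2 + c 3 ∨ ⌊δ * ((d - c 2 - c 3 : ℕ) : ℚ)⌋₊ + 1 ≤ c 0 + c 1 ∨
      (⌈δ * ((d - c 2 - c 3 : ℕ) : ℚ)⌉₊ ≤ c 0 + c 1 ∧ ⌈ρ * ((d - c 2 - c 3 : ℕ) : ℚ)⌉₊ ≤ c 1)) :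
    DeltaFaceGe x y z w d δ ρ f :=
  mem_of_forall_minExponents_uPow_mem ht fun c hc => uPow_mem_deltaFaceGeIdeal x y z w d δ ρ (h c hc)

/-- The `DeltaFaceGe (δ, ρ)` region is up-closed (`δ, ρ ≥ 0`). [folklore] -/
theorem deltaFaceRegion_mono {d : ℕ} {δ ρ : ℚ} (hδ : 0 ≤ δ) (hρ : 0 ≤ ρ) {b a : Fin 4 → ℕ} (hba : b ≤ a)
    (hb : d ≤ b 2 + b 3 ∨ ⌊δ * ((d - b 2 - b 3 : ℕ) : ℚ)⌋₊ + 1 ≤ b 0 + b 1 ∨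
      (⌈δ * ((d - b 2 - b 3 : ℕ) : ℚ)⌉₊ ≤ b 0 + b 1 ∧ ⌈ρ * ((d - b 2 - b 3 : ℕ) : ℚ)⌉₊ ≤ b 1)) :
    d ≤ a 2 + a 3 ∨ ⌊δ * ((d - a 2 - a 3 : ℕ) : ℚ)⌋₊ + 1 ≤ a 0 + a 1 ∨
      (⌈δ * ((d - a 2 - a 3 : ℕ) : ℚ)⌉₊ ≤ a 0 + a 1 ∧ ⌈ρ * ((d - a 2 - a 3 : ℕ) : ℚ)⌉₊ ≤ a 1) := by
  have h0 : b 0 ≤ a 0 := hba 0; have h1 : b 1 ≤ a 1 := hba 1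
  have h2 : b 2 ≤ a 2 := hba 2; have h3 : b 3 ≤ a 3 := hba 3
  have hm : d - a 2 - a 3 ≤ d - b 2 - b 3 := by omega
  rcases hb with hb | hb | ⟨hb0, hb1⟩
  · left; omega
  · right; left; exact le_trans (Nat.add_le_add_right (floor_mul_mono hδ hm) 1) (hb.trans (Nat.add_le_add h0 h1))
  · right; right
    exact ⟨(ceil_mul_mono hδ hm).trans (hb0.trans (Nat.add_le_add h0 h1)), (ceil_mul_mono hρ hm).trans (hb1.trans h1)⟩

/-! ## §3 Two consequences -/

/-- **`f ∈ 𝔪^d ⇒ DeltaGe 1`**: every point has `a + b ≥ 1`. [folklore] -/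
theorem deltaGe_one_of_mem_pow [IsLocalRing S] {x y z w : S} (ht : IsRsopPart ![x, y, z, w])
    (hspan : Ideal.span {x, y, z, w} = maximalIdeal S) {d : ℕ} {f : S} (hfd : f ∈ maximalIdeal S ^ d) :
    DeltaGe x y z w d 1 f := by
  refine deltaGe_of_forall_minExponents ht 1 fun c hc => ?_
  have hdeg := (mem_pow_iff_forall_minExponents ht hspan d f).mp hfd c hc
  rw [sum_four] at hdeg
  by_cases hzw : d ≤ c 2 + c 3
  · exact Or.inl hzw
  · right; rw [one_mul, Nat.ceil_natCast]; omega

/-- **The `x`-near region gives `DeltaFaceGt (1, 0)`**: every point with `A + 2B ≥ 2` has `A + B > 1` or (`A + B = 1` and `B > 0`).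
[folklore] -/
theorem deltaFaceGt_one_zero_of_nearX [IsLocalRing S] {x y z w : S} (ht : IsRsopPart ![x, y, z, w]) {d : ℕ} {f : S}
    (hG : ∀ e ∈ minExponents ![x, y, z, w] f, 2 * d ≤ e 0 + 2 * e 1 + 2 * e 2 + 2 * e 3) :
    DeltaFaceGt x y z w d 1 0 f := by
  refine deltaFaceGt_of_forall_minExponents ht 1 0 fun c hc => ?_
  have h := hG c hc
  by_cases hzw : d ≤ c 2 + c 3
  · exact Or.inl hzw
  · right
    rw [one_mul, Nat.floor_natCast, Nat.ceil_natCast, zero_mul, Nat.floor_zero]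
    by_cases h1 : 1 ≤ c 1
    · right; constructor <;> omega
    · left; omega

end Summit.ResolutionOfSingularities.ResolutionOfSingularities.Theorems.SwitchingDichotomy.BetaNewton

end
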